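import Summits.BirchSwinnertonDyer.BirchSwinnertonDyer.Theorems.GenusKolyvaginAtTwoGenusPrimitiveSupplyAtTwoKolyvaginClassAtTwo
import Literature.NumberTheory.EllipticCurves.BSDRankZeroDensity
import HarnessLib

/-!
# Route `GenusKolyvaginAtTwo`, LINE 18 `plus_descent` on L_T `PowDvdShaCardAtTwoRT` (stmt-BirchSwinnertonDyer-23242), stub 3a⁗ —
# TOOLBOX: the ORDER of Kolyvagin's class at `2` from the divisibility of the derived point — `P(n) ∉ 2E(K[n]) ⟹ ord c_M(n) = 2^M`

Seat `bsd-line-gk2-p1` g14 (LEAD seat 1/3, cell `bsd-f1-sign2`), `--supports stmt-BirchSwinnertonDyer-23242 --as helper`.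
THEOREMS ONLY (no definition, no named fact, no `sorry`).  Nothing here closes an item; BSD is not proved by any of this.

The crux's certificate `hPn` («some square-free Kolyvagin level `n` carries a `2`-PRIMITIVE derived point `P(n)`») is stated in the
currency of POINTS; the ladder / rung machinery of LINE 18 (gk2-p2 `…RTShaLadder`, this seat's `…RTRelaxedRung`, `…RTInvariantRung`) and
LINE 6's exactness theorem consume classes of a given ORDER (`addOrderOf c = 2^a`; LINE 6: `2^{M−1}·c₂(ℓ₀) ≠ 0`).  This file is the
dictionary, McCallum's Cor. 4.5 at `2` upgraded from «`c_M(n) ≠ 0 ⟺ 2^M ∤ P(n)`» (this lineage's g3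
`GenusKoly.kolyvaginClass_two_ne_zero_iff_not_pow_dvd`) to the exact order:

* §1 `kolyvaginClass_zsmul` — generic (any field, any level `n`): Kolyvagin's class is `ℤ`-linear in the point,
  `c(k•P) = k•c(P)` (root independence `kolyvaginClass_eq_cls` + `KolyvaginCocycle.cls_zsmul`);
* §2 **`addOrderOf_kolyvaginClass_two_eq_pow_of_not_two_dvd`** — on the crux's frame (`W` globally minimal, `ρ̄_{E,2}` onto, `K` imaginary
  quadratic with odd `d_K ≠ −3` and the Heegner hypothesis), for a square-free product `n` of Kolyvagin primes at `2` of index `≥ M ≥ 1`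
  and Kolyvagin–Heegner data at the divisors of `n`: **`P(n) ∉ 2E(K[n]) ⟹ addOrderOf c_M(n) = 2^M`** (`2^{M−1}·c_M(n) = c_M(2^{M−1}P(n)) ≠ 0`
  because `2^{M−1}P(n) ∈ 2^M E(K[n])` would force `P(n) ∈ 2E(K[n])` by `E(K[n])[2^∞] = 0`, `GenusKoly.heegner_two_pow_torsion_free`);
  more generally `pow_pred_zsmul_kolyvaginClass_two_ne_zero`.

With gk2-p3's sign theorem (`KolyvaginClassSign.sign_conjAct_kolyvaginClass_two`) and `…RTInvariantRung`, the prime-level rank-zero side of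
3a⁗ reads: `hPn` at `n = ℓ` ⟹ `c_{M₀}(ℓ)` has order `2^{M₀}` and is `τ`-invariant ⟹ (once Selmer over `K`: Lemma 4.3 over `K` + Q2 at `λ`)
`2M₀ − 2 ≤ ord₂ #Ш(E/ℚ)[2^∞]`.

References: [McCallumLMS1991] §4 (4)–(6), Cor. 4.5; [GrossLMS1991] §4 (4.4), Prop. 4.7 (1), Lemma 4.3; [WZhang2014] Notations (xii).
-/

set_option autoImplicit false
-- the Theorems namespace of this sub repeats the summit name by design (D-0017 nested layout)
set_option linter.dupNamespace false

noncomputable section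

open scoped Classical

/-! ## §1 `c(k•P) = k•c(P)` for the generic Kolyvagin class -/

namespace Summit.BirchSwinnertonDyer.BirchSwinnertonDyer.Theorems.GenusExact.PlusDescent

open Literature.NumberTheory.EllipticCurves Literature.NumberTheory.EllipticCurves.KolyvaginCocycle WeierstrassCurve

universe u

/-- **Kolyvagin's class is `ℤ`-linear in the point**: for `P` with `(g−1)P ∈ nA` and any `k : ℤ`, `c(k•P) = k•c(P)` in `H¹(K, E[n])`
(the class does not depend on the chosen `n`-th root, and with the root `kQ` of `kP` McCallum's cocycle scales).
[cite: GrossLMS1991, §4 (4.4)] [cite: McCallumLMS1991, §4 (6)] -/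
theorem kolyvaginClass_zsmul {K : Type u} [Field K] (V : WeierstrassCurve K) (n : ℤ)
    (hdiv : ∀ P : geomPoints V, ∃ Q : geomPoints V, n • Q = P)
    {A : AddSubgroup (geomPoints V)} (hA : IsAdmissible (Field.absoluteGaloisGroup K) A n)
    {P : geomPoints V} (hP : P ∈ invPoints (Field.absoluteGaloisGroup K) A n) (k : ℤ) :
    kolyvaginClass V n hdiv hA (k • P) (AddSubgroup.zsmul_mem _ hP k) = k • kolyvaginClass V n hdiv hA P hP := by
  obtain ⟨Q, hQ⟩ := hdiv P
  have hkQ : n • (k • Q) = k • P := by rw [smul_comm, hQ]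
  rw [kolyvaginClass_eq_cls hA hP hQ, kolyvaginClass_eq_cls hA (AddSubgroup.zsmul_mem _ hP k) hkQ]
  exact cls_zsmul hA _ hP hQ k _ hkQ

end Summit.BirchSwinnertonDyer.BirchSwinnertonDyer.Theorems.GenusExact.PlusDescent

/-! ## §2 On the crux's frame at `2`: the order of `c_M(n)` from the `2`-primitivity of `P(n)` -/

namespace Summit.BirchSwinnertonDyer.BirchSwinnertonDyer.Theorems.GenusExact.PlusDescent

open NumberField WeierstrassCurve Field Literature.NumberTheory.EllipticCurves
  Literature.NumberTheory.EllipticCurves.ModularForms Literature.NumberTheory.EllipticCurves.KolyvaginCocycle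
  Summit.BirchSwinnertonDyer.Rank1Residual.X11b

variable {W : WeierstrassCurve ℚ} [NeZero (W.conductorNorm ℤ)] {K : Type} [Field K] [NumberField K]
  {Dt : ModularParametrizationData W (W.conductorNorm ℤ)} {β : ℤ} {ι : K →+* ℂ}

/-- **`2^j·c_M(n) ≠ 0` for `j < M` when `P(n) ∉ 2E(K[n])`** on the crux's frame: `2^j·c_M(n) = c_M(2^j P(n))` (§1) vanishes iff
`2^j P(n) ∈ 2^M E(K[n])` (McCallum Cor. 4.5 for the point `2^j P(n)`, `kolyvaginClass_eq_zero_iff` at `N = Gal(K̄/K[n])`), and then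
`2^j (2^{M−j} B − P(n)) = 0` with `E(K[n])[2^∞] = 0` gives `P(n) = 2·(2^{M−j−1} B)`.
[cite: McCallumLMS1991, §4 Cor. 4.5] [cite: GrossLMS1991, Prop. 4.7 (1) and Lemma 4.3] -/
theorem pow_zsmul_kolyvaginClass_two_ne_zero [W.IsElliptic] [W.IsGloballyMinimal] (hK : IsImaginaryQuadratic K)
    (hodd : Odd (NumberField.discr K)) (h3 : NumberField.discr K ≠ -3)
    (hH : SatisfiesHeegnerHypothesis (W.conductorNorm ℤ) K) (hsurj : W.HasSurjectiveModNGaloisRep ((2 : ℤ) ^ 1))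
    {n M : ℕ} (hn : Squarefree n)
    (hkol : ∀ q ∈ n.primeFactors,
      Zhang2014.IsKolyvaginPrime (W.conductorNorm ℤ) W K 2 q ∧ M ≤ Zhang2014.kolyvaginIndex W 2 q)
    (d : (m : ℕ) → m ∣ n → KolyvaginHeegnerData Dt β ι m)
    (hprim : ¬ ∃ Q : (W.baseChange (ringClassField K ι n)).toAffine.Point, (2 : ℤ) • Q = (d n dvd_rfl).derivedPoint)
    {j : ℕ} (hj : j < M) :
    (((2 ^ j : ℕ) : ℤ)) • (d n dvd_rfl).kolyvaginClass Nat.prime_two M ≠ 0 := by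
  have hA := GenusKoly.isAdmissible_pointsSubgroup_two hK hodd hH hsurj hn.ne_zero (d n dvd_rfl) M
  have hP := Three.KolyCert.toGeomPoints_derivedPoint_mem_invPoints_of_dvd_zhang hK ι Dt Nat.prime_two
    (GenusKoly.heegner_isCoprime_conductorNorm_discr hK hH) (GenusKoly.discr_lt_neg_four_of_odd hK hodd h3) hn hkol d n
    dvd_rfl
  set dn := d n dvd_rfl with hdn
  rw [dn.kolyvaginClass_of_admissible Nat.prime_two M hA hP, ← kolyvaginClass_zsmul]
  -- the point `2^j • P(n)`, as the image of a `K[n]`-point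
  have hpt : (((2 ^ j : ℕ) : ℤ)) • dn.toGeomPoints dn.derivedPoint =
      dn.toGeomPoints ((((2 ^ j : ℕ) : ℤ)) • dn.derivedPoint) := (map_zsmul _ _ _).symm
  rw [KolyvaginDescent.kolyvaginClass_congr_point hA
      (hP' := by rw [← hpt]; exact AddSubgroup.zsmul_mem _ hP _) hpt]
  intro h0
  obtain ⟨_, ⟨B, rfl⟩, hB⟩ := (kolyvaginClass_eq_zero_iff hA _
      (N := {g : absoluteGaloisGroup K | ∀ x : ringClassField K ι n,
        (show AlgebraicClosure K ≃ₐ[K] AlgebraicClosure K from g) (dn.emb x) = dn.emb x})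
      (fun g hg ↦ Three.KolyCert.smul_toGeomPoints_of_forall_emb dn g hg _)
      (fun v hv ↦ Three.KolyCert.mem_pointsSubgroup_of_forall_smul_eq dn v fun g hg ↦ hv g hg)).mp h0
  -- `2^M • B = 2^j • P(n)` in `E(K[n])`
  have hB' : (((2 ^ M : ℕ) : ℤ)) • B = (((2 ^ j : ℕ) : ℤ)) • dn.derivedPoint := by
    apply Affine.Point.map_injective (W' := W) dn.emb.toRatAlgHom
    change dn.toGeomPoints ((((2 ^ M : ℕ) : ℤ)) • B) = dn.toGeomPoints ((((2 ^ j : ℕ) : ℤ)) • dn.derivedPoint)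
    rw [map_zsmul]
    exact hB
  obtain ⟨e, he⟩ := Nat.exists_eq_add_of_lt hj
  -- `2^j • (2^{e+1} • B − P(n)) = 0`, hence `P(n) = 2 • (2^e • B)`
  have hzero : (((2 ^ j : ℕ) : ℤ)) • ((((2 ^ (e + 1) : ℕ) : ℤ)) • B - dn.derivedPoint) = 0 := by
    rw [zsmul_sub, smul_smul, ← hB', he]
    push_cast
    ring_nf
    simp
  have hfree := GenusKoly.heegner_two_pow_torsion_free (ι := ι) hK hodd hH hsurj hn.ne_zero j _ hzero
  refine hprim ⟨(((2 ^ e : ℕ) : ℤ)) • B, ?_⟩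
  rw [sub_eq_zero] at hfree
  rw [smul_smul, ← hfree]
  push_cast
  ring_nf

/-- **`P(n) ∉ 2E(K[n]) ⟹ addOrderOf c_M(n) = 2^M`** (`M ≥ 1`) on the crux's frame: the `2`-primitive derived point of `hPn` gives a
Kolyvagin class of FULL order `2^M` at every admissible level `M ≤ M(n)` — the class-order currency consumed by the ladder/rung machinery
(LINE 18 §5/§7 of `…RTRelaxedRung`/`…RTInvariantRung` with `a = M`; LINE 6 `sel₁_eq_and_card_sel₂_eq_of_primitive` with `2^{M−1} c ≠ 0`).
[cite: McCallumLMS1991, §4 Cor. 4.5] [cite: GrossLMS1991, Prop. 4.7 (1) and Lemma 4.3] -/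
theorem addOrderOf_kolyvaginClass_two_eq_pow_of_not_two_dvd [W.IsElliptic] [W.IsGloballyMinimal] (hK : IsImaginaryQuadratic K)
    (hodd : Odd (NumberField.discr K)) (h3 : NumberField.discr K ≠ -3)
    (hH : SatisfiesHeegnerHypothesis (W.conductorNorm ℤ) K) (hsurj : W.HasSurjectiveModNGaloisRep ((2 : ℤ) ^ 1))
    {n M : ℕ} (hn : Squarefree n) (hM : 1 ≤ M)
    (hkol : ∀ q ∈ n.primeFactors,
      Zhang2014.IsKolyvaginPrime (W.conductorNorm ℤ) W K 2 q ∧ M ≤ Zhang2014.kolyvaginIndex W 2 q)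
    (d : (m : ℕ) → m ∣ n → KolyvaginHeegnerData Dt β ι m)
    (hprim : ¬ ∃ Q : (W.baseChange (ringClassField K ι n)).toAffine.Point, (2 : ℤ) • Q = (d n dvd_rfl).derivedPoint) :
    addOrderOf ((d n dvd_rfl).kolyvaginClass Nat.prime_two M) = 2 ^ M := by
  obtain ⟨m, rfl⟩ := Nat.exists_eq_add_of_le hM
  rw [Nat.add_comm] at *
  refine addOrderOf_eq_prime_pow (p := 2) (n := m) ?_ ?_
  · rw [← natCast_zsmul]
    exact pow_zsmul_kolyvaginClass_two_ne_zero hK hodd h3 hH hsurj hn hkol d hprim (Nat.lt_succ_self m)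
  · rw [← natCast_zsmul]
    exact zsmul_galH1Torsion_eq_zero (W.baseChange K) _ _

end Summit.BirchSwinnertonDyer.BirchSwinnertonDyer.Theorems.GenusExact.PlusDescent

end
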